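import Literature.Computability.Cryptography.HallgrenCandidateCheckFP
import HarnessLib

/-!
# A family of infrastructures presented by step programs: the walk table and the candidate test in polynomial time

Topic `Computability/Cryptography`; sequel of `InfrastructureWalkFP.lean` (`IntWalkOps`, `FPSpec`,
`codeFP_tableI`, `tableI_eq_table`) and `HallgrenCandidateCheckFP.lean` (`checkAtI_iff`,
`codeFP_checkAtI`). Those files compute Hallgren's periodic function `h̃_N` and the candidate test of
Jozsa 2003, §10 (c) from an `IntWalkOps` family CARRYING an `FPSpec` (a validity predicate closed under
the steps with polynomial size bounds). This file supplies the `FPSpec` in the situation every concrete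
infrastructure is in (the principal cycle of a real quadratic order, `HallgrenWalkOpsK.hallgrenSpec`; the
cycle of reduced ideals of a complex cubic order, Buchmann–Williams 1988, §3): the walk is ASSEMBLED FROM
THREE STEP PROGRAMS — a baby step `rhoS` and a giant step `starS` returning the new label together with a
fixed-point logarithm, and a start-up `unitS` returning the unit label with a distance offset —, the defect
evaluator is the clamp of `starS.2 + unitS.2` to a computable bound `KI`, and on every ADMISSIBLE instance
the assembled rational walk data carry a `GiantStepCycle` whose labels have polynomially bounded codes.
Validity is then "being a label of the cycle" (closed under the steps by `rho_lab`, `star_lab`), the gap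
values are bounded through `ghat_spec`/`gap_le`, the defect values by the clamp, and the two programs come
out as plain `FP` string functions with their meaning on admissible instances:

* `abs_clamp_le`, `length_latticeCode_le` (codes of lattices
  `(denominator, entries)` are short);
* **`exists_table_passes_fn_of_stepPrograms`** — `FP` functions `Ftab`, `Fpas` with
  `Ftab ⟨d, N, v, 1^{s₀}, 1^T, 1^B⟩ = code (G_d.table N s₀ T B v)` and
  `Fpas ⟨d, N, δ₀, 1^{s₀}, 1^T, 1^B, sc⟩ = [true] ↔ G_d.Passes (sc/N) (δ₀/N) s₀ T B` for admissible `d`.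

Theorem-only file, no named facts, no definitions.

## References

* R. Jozsa, *Notes on Hallgren's efficient quantum algorithm for solving Pell's equation*,
  arXiv:quant-ph/0302134 (2003), §9 Thm. 5, §10 Prop. 36 (ii), §10 (c). [Jozsa2003]
* J. Buchmann, H. C. Williams, *On the infrastructure of the principal ideal class of an algebraic
  number field of unit rank one*, Math. Comp. 50 (1988), §3. [BuchmannWilliams1988Infrastructure]
* S. Arora, B. Barak, *Computational Complexity*, CUP 2009, §1.3. [AroraBarak2009]
-/

noncomputable section

open scoped Classical

namespace Literature.Computability.Cryptography

namespace IntWalkOps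

open Literature.Computability.Complexity Literature.Computability.Complexity.CodeFP Polynomial WalkData

/-! ### Size lemmas -/

/-- The clamp of `x` to `[-K, K]` is at most `K` in absolute value (`K ≥ 0`). [folklore] -/
theorem abs_clamp_le {K : ℤ} (hK : 0 ≤ K) (x : ℤ) : |max (-K) (min K x)| ≤ K :=
  abs_le.2 ⟨le_max_left _ _, max_le (by linarith) (min_le_left _ _)⟩

/-- **Lattice codes are short**: the code `⟨bin den, [dp h₁, …, dp h_L]⟩` of a lattice given by a
denominator `≤ M` and at most `L` entries of absolute value `≤ M` has length `≤ (6L + 2)(size M + 1)`.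
[cite: Jozsa2003, §9 Thm. 5 ("each reduced ideal will have a poly log d sized description")] -/
theorem length_latticeCode_le {M L : ℕ} {c : ℕ × List ℤ} (hden : c.1 ≤ M) (hlen : c.2.length ≤ L)
    (hent : ∀ h ∈ c.2, h.natAbs ≤ M) :
    (pairE natE (rawE intE) c).length ≤ (6 * L + 2) * (M.size + 1) := by
  obtain ⟨den, l⟩ := c
  simp only at hden hlen hent
  have hsum : ∀ l : List ℤ, (∀ h ∈ l, h.natAbs ≤ M) →
      (l.map (fun a => 2 * (intE a).length + 2)).sum ≤ l.length * (6 * M.size + 6) := by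
    intro l hl
    induction l with
    | nil => simp
    | cons a l ih =>
      have ha := (length_intE_le a).trans (Nat.add_le_add_right (Nat.mul_le_mul_left 3 (Nat.size_le_size (hl a (by simp)))) 2)
      have ih' := ih (fun h hh => hl h (List.mem_cons_of_mem a hh))
      simp only [List.map_cons, List.sum_cons, List.length_cons]
      nlinarith
  have h1 : (natE den).length ≤ M.size := by rw [length_natE]; exact Nat.size_le_size hden
  have h2 := hsum l hent
  simp only [pairE_apply, length_boolPair, length_rawE]
  have h3 : l.length * (6 * M.size + 6) ≤ L * (6 * M.size + 6) := Nat.mul_le_mul_right _ hlen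
  nlinarith

/-! ### The programs of a family of cycles presented by step programs -/

section Steps

variable {α ι : Type} {eα : α → List Bool} {eι : ι → List Bool}

/-- **The walk table and the candidate test of a family of infrastructures are polynomial time.**
Let `rhoS`, `starS`, `unitS` be polynomial-time step programs on instance codes `eα` and label codes
`eι` (each returning a label and a fixed-point logarithm), `KI` a computable defect bound and `pr` a
computable (unary) precision, and suppose that on every admissible instance `a` (`P a`) the assembled
walk data — unit `(unitS a).1`, steps `(rhoS (a, c)).1`, `(starS (a, (c₁, c₂))).1`, gap `(rhoS (a, c)).2`,
defect `clamp_{KI a} ((starS (a, (c₁, c₂))).2 + (unitS a).2)`, all read at precision `pr a` — carry a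
`GiantStepCycle` `G a` whose labels have codes bounded by a polynomial `B` of the instance code length,
with `G.G + 1 ≤ 2^B`, `KI < 2^B`, `pr ≤ B`. Then there are `Ftab, Fpas ∈ FP` such that for admissible
`a` and `N > 0`, `Ftab ⟨a, N, v, 1^{s₀}, 1^T, 1^B⟩` is the code of `(G a).table N s₀ T B v` and
`Fpas ⟨a, N, δ₀, 1^{s₀}, 1^T, 1^B, sc⟩ = [true] ↔ (G a).Passes (sc/N) (δ₀/N) s₀ T B` (Jozsa's
"h̃_N is computable in polynomial time" and requirement (c) of his Thm. 6, for any infrastructure given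
by step programs). [cite: Jozsa2003, §9 Thm. 5, §10 Prop. 36 (ii), §10 (c)] [cite: BuchmannWilliams1988Infrastructure, §3] -/
theorem exists_table_passes_fn_of_stepPrograms (he : Function.Injective eι)
    (rhoS : α × ι → ι × ℤ) (starS : α × (ι × ι) → ι × ℤ) (unitS : α → ι × ℤ) (KI : α → ℕ) (pr : α → ℕ)
    (hrho : CodeFP (pairE eα eι) (pairE eι intE) rhoS)
    (hstar : CodeFP (pairE eα (pairE eι eι)) (pairE eι intE) starS)
    (hunit : CodeFP eα (pairE eι intE) unitS) (hKI : CodeFP eα natE KI) (hpr : CodeFP eα unE pr)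
    (P : α → Prop) (G : ∀ a, P a → GiantStepCycle ι)
    (hG : ∀ a (h : P a), (G a h).toWalkData = IntWalkOps.toWalkData
      (⟨fun d => (unitS d).1, fun d c => (rhoS (d, c)).1, fun d c₁ c₂ => (starS (d, (c₁, c₂))).1,
        fun d c => (rhoS (d, c)).2,
        fun d c₁ c₂ => max (-(KI d : ℤ)) (min (KI d : ℤ) ((starS (d, (c₁, c₂))).2 + (unitS d).2)),
        KI, pr⟩ : IntWalkOps α ι) a)
    (B : Polynomial ℕ)
    (hlab : ∀ a (h : P a) (m : ℤ), (eι ((G a h).lab m)).length ≤ B.eval (eα a).length)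
    (hGG : ∀ a (h : P a), (G a h).G + 1 ≤ (2 : ℝ) ^ B.eval (eα a).length)
    (hK : ∀ a, P a → KI a < 2 ^ B.eval (eα a).length)
    (hp : ∀ a, P a → pr a ≤ B.eval (eα a).length) :
    ∃ Ftab ∈ FP, ∃ Fpas ∈ FP, ∀ a (h : P a) (N : ℕ), 0 < N →
      (∀ (v : ℤ) (s₀ T Bf : ℕ),
        Ftab (pairE eα (pairE natE (pairE intE (pairE unE (pairE unE unE)))) (a, N, v, s₀, T, Bf)) =
          pairE eι intE ((G a h).table N s₀ T Bf v)) ∧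
      (∀ (δ₀ s₀ T Bf : ℕ) (sc : ℤ),
        Fpas (pairE eα (pairE natE (pairE natE (pairE unE (pairE unE (pairE unE intE))))) (a, N, δ₀, s₀, T, Bf, sc)) =
          [true] ↔ (G a h).Passes ((sc : ℚ) / N) ((δ₀ : ℚ) / N) s₀ T Bf) := by
  -- the integer walk operations on the admissible instances
  let O : IntWalkOps {a // P a} ι :=
    ⟨fun d => (unitS d.1).1, fun d c => (rhoS (d.1, c)).1, fun d c₁ c₂ => (starS (d.1, (c₁, c₂))).1,
      fun d c => (rhoS (d.1, c)).2,
      fun d c₁ c₂ => max (-(KI d.1 : ℤ)) (min (KI d.1 : ℤ) ((starS (d.1, (c₁, c₂))).2 + (unitS d.1).2)),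
      fun d => KI d.1, fun d => pr d.1⟩
  have hO : ∀ d : {a // P a}, (G d.1 d.2).toWalkData = O.toWalkData d := fun d => hG d.1 d.2
  have hunitEq : ∀ d : {a // P a}, (G d.1 d.2).unit = O.unit d := fun d => by
    have := congrArg WalkData.unit (hO d); simpa [IntWalkOps.toWalkData] using this
  have hrhoEq : ∀ d : {a // P a}, (G d.1 d.2).rho = O.rho d := fun d => by
    have := congrArg WalkData.rho (hO d); simpa [IntWalkOps.toWalkData] using this
  have hstarEq : ∀ d : {a // P a}, (G d.1 d.2).star = O.star d := fun d => by
    have := congrArg WalkData.star (hO d); simpa [IntWalkOps.toWalkData] using this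
  have hghatEq : ∀ d : {a // P a}, (G d.1 d.2).ghat = fun c => (O.gInt d c : ℚ) / 2 ^ O.prec d := fun d => by
    have := congrArg WalkData.ghat (hO d); simpa [IntWalkOps.toWalkData] using this
  -- the instance code restricted to the admissible instances
  have hval : CodeFP (eα ∘ Subtype.val) eα (Subtype.val : {a // P a} → α) := by
    obtain ⟨f, hf, hfe⟩ := CodeFP.id eα
    exact ⟨f, hf, fun d => hfe d.1⟩
  -- the specification
  have S : O.FPSpec (eα ∘ Subtype.val) eι :=
    { Valid := fun d c => ∃ m, c = (G d.1 d.2).lab m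
      valid_unit := fun d => ⟨0, by rw [(G d.1 d.2).lab_zero, hunitEq]⟩
      valid_rho := fun d c hc => by
        obtain ⟨m, rfl⟩ := hc
        exact ⟨m + 1, by rw [← (G d.1 d.2).rho_lab m, hrhoEq]⟩
      valid_star := fun d c₁ c₂ h₁ h₂ => by
        obtain ⟨m₁, rfl⟩ := h₁
        obtain ⟨m₂, rfl⟩ := h₂
        obtain ⟨m, hm, -⟩ := (G d.1 d.2).star_lab m₁ m₂
        exact ⟨m, by rw [← hstarEq]; exact hm.symm⟩
      bound := 6 * B + 2
      len_lab := fun d c hc => by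
        obtain ⟨m, rfl⟩ := hc
        refine (hlab d.1 d.2 m).trans ?_
        simp only [Function.comp_apply, eval_add, eval_mul, eval_ofNat]
        omega
      len_g := fun d c hc => by
        obtain ⟨m, rfl⟩ := hc
        simp only [Function.comp_apply, eval_add, eval_mul, eval_ofNat]
        -- `|gInt| = 2ᵖ |ghat| ≤ 2ᵖ (gap + η) < 2ᵖ (G + 1) ≤ 2^B 2^B`
        set Be := B.eval (eα d.1).length with hBe
        suffices hlt : (O.gInt d ((G d.1 d.2).lab m)).natAbs < 2 ^ (2 * Be) by
          have h1 := Nat.size_le.2 hlt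
          have h2 := length_intE_le (O.gInt d ((G d.1 d.2).lab m))
          omega
        have hspec := (G d.1 d.2).ghat_spec m
        have hgap := (G d.1 d.2).gap_le m
        have hη := (G d.1 d.2).η_le
        have hGG' := hGG d.1 d.2
        have hp' := hp d.1 d.2
        have hgh : ((G d.1 d.2).ghat ((G d.1 d.2).lab m) : ℝ) = (O.gInt d ((G d.1 d.2).lab m) : ℝ) / 2 ^ pr d.1 := by
          rw [hghatEq]; push_cast; rfl
        rw [hgh] at hspec
        have hpow : (0 : ℝ) < 2 ^ pr d.1 := by positivity
        have habs : |(O.gInt d ((G d.1 d.2).lab m) : ℝ)| < 2 ^ pr d.1 * 2 ^ Be := by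
          have h1 : |(O.gInt d ((G d.1 d.2).lab m) : ℝ) / 2 ^ pr d.1| < 2 ^ Be := by
            have := abs_sub_abs_le_abs_sub ((O.gInt d ((G d.1 d.2).lab m) : ℝ) / 2 ^ pr d.1)
              ((G d.1 d.2).P (m + 1) - (G d.1 d.2).P m)
            have hg0 := (G d.1 d.2).gap_pos m
            rw [abs_of_pos hg0] at this
            linarith
          rw [abs_div, abs_of_pos hpow, div_lt_iff₀ hpow] at h1
          linarith
        have hpp : (2 : ℝ) ^ pr d.1 * 2 ^ Be ≤ 2 ^ (2 * Be) := by
          rw [← pow_add]; exact pow_le_pow_right₀ (by norm_num) (by omega)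
        have hlt : ((O.gInt d ((G d.1 d.2).lab m)).natAbs : ℝ) < (2 : ℝ) ^ (2 * Be) := by
          rw [Nat.cast_natAbs, Int.cast_abs]; linarith
        exact_mod_cast hlt
      len_k := fun d c₁ c₂ _ _ => by
        simp only [Function.comp_apply, eval_add, eval_mul, eval_ofNat]
        have hcl := abs_clamp_le (K := (KI d.1 : ℤ)) (by positivity) ((starS (d.1, (c₁, c₂))).2 + (unitS d.1).2)
        have h1 : (O.kInt d c₁ c₂).natAbs ≤ KI d.1 := by
          have : ((O.kInt d c₁ c₂).natAbs : ℤ) ≤ KI d.1 := by rw [Int.natCast_natAbs]; exact hcl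
          exact_mod_cast this
        have h2 := Nat.size_le.2 (lt_of_le_of_lt h1 (hK d.1 d.2))
        have h3 := length_intE_le (O.kInt d c₁ c₂)
        omega
      h_unit := ((hunit.comp hval).fst').congr fun _ => rfl
      h_rho := ((hrho.comp ((hval.comp (fst _ _)).pair (snd _ _))).fst').congr fun _ => rfl
      h_star := ((hstar.comp ((hval.comp (fst _ _)).pair (snd _ _))).fst').congr fun _ => rfl
      h_g := ((hrho.comp ((hval.comp (fst _ _)).pair (snd _ _))).snd').congr fun _ => rfl
      h_k := by
        have hKz : CodeFP (pairE (eα ∘ Subtype.val) (pairE eι eι)) intE (fun p => (KI p.1.1 : ℤ)) :=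
          (intOfNat.comp (hKI.comp (hval.comp (fst _ _))) :)
        have hneg : CodeFP (pairE (eα ∘ Subtype.val) (pairE eι eι)) intE (fun p => -(KI p.1.1 : ℤ)) := (intNeg.comp hKz :)
        have hsum : CodeFP (pairE (eα ∘ Subtype.val) (pairE eι eι)) intE
            (fun p => (starS (p.1.1, p.2)).2 + (unitS p.1.1).2) :=
          (intAdd.comp ((hstar.comp ((hval.comp (fst _ _)).pair (snd _ _))).snd'.pair
            (hunit.comp (hval.comp (fst _ _))).snd') :)
        have hmin : CodeFP (pairE (eα ∘ Subtype.val) (pairE eι eι)) intE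
            (fun p => min (KI p.1.1 : ℤ) ((starS (p.1.1, p.2)).2 + (unitS p.1.1).2)) :=
          (((intLe.comp (hKz.pair hsum)) :).ite hKz hsum).congr fun p => by
            by_cases h : (KI p.1.1 : ℤ) ≤ (starS (p.1.1, p.2)).2 + (unitS p.1.1).2 <;> simp [h, min_def]
        refine ((((intLe.comp (hneg.pair hmin)) :).ite hmin hneg).congr fun p => ?_)
        by_cases h : -(KI p.1.1 : ℤ) ≤ min (KI p.1.1 : ℤ) ((starS (p.1.1, p.2)).2 + (unitS p.1.1).2) <;>
          simp [h, max_def, O]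
      h_K := (hKI.comp hval).congr fun _ => rfl
      h_prec := (hpr.comp hval).congr fun _ => rfl }
  -- the two programs
  obtain ⟨Ft, hFt, hFte⟩ := S.codeFP_tableI
  have hchk := fun j => IntWalkOps.codeFP_checkAtI S he j
  obtain ⟨Fp, hFp, hFpe⟩ := ((hchk 0).or ((hchk 1).or (hchk 2)) :)
  refine ⟨Ft, hFt, Fp, hFp, fun a h N hN => ⟨fun v s₀ T Bf => ?_, fun δ₀ s₀ T Bf sc => ?_⟩⟩
  · have e := hFte (⟨a, h⟩, N, v, s₀, T, Bf)
    simp only at e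
    rw [O.tableI_eq_table _ hN, ← hO ⟨a, h⟩] at e
    exact e
  · have e := hFpe (⟨a, h⟩, N, δ₀, s₀, T, Bf, sc)
    simp only at e
    have e' : Fp (pairE eα (pairE natE (pairE natE (pairE unE (pairE unE (pairE unE intE))))) (a, N, δ₀, s₀, T, Bf, sc)) =
        bitE (decide (O.checkAtI ⟨a, h⟩ N δ₀ s₀ T Bf sc 0) || (decide (O.checkAtI ⟨a, h⟩ N δ₀ s₀ T Bf sc 1) ||
          decide (O.checkAtI ⟨a, h⟩ N δ₀ s₀ T Bf sc 2))) := e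
    rw [e', checkAtI_iff (G a h) (hO ⟨a, h⟩) hN, checkAtI_iff (G a h) (hO ⟨a, h⟩) hN,
      checkAtI_iff (G a h) (hO ⟨a, h⟩) hN]
    unfold GiantStepCycle.Passes
    constructor
    · intro hb
      have hb' : (decide ((G a h).CheckAt ((sc : ℚ) / N) ((δ₀ : ℚ) / N) s₀ T Bf 0) ||
          (decide ((G a h).CheckAt ((sc : ℚ) / N) ((δ₀ : ℚ) / N) s₀ T Bf 1) ||
            decide ((G a h).CheckAt ((sc : ℚ) / N) ((δ₀ : ℚ) / N) s₀ T Bf 2))) = true := by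
        simpa [bitE] using hb
      simp only [Bool.or_eq_true, decide_eq_true_eq] at hb'
      rcases hb' with h0 | h1 | h2
      · exact ⟨0, by norm_num, h0⟩
      · exact ⟨1, by norm_num, h1⟩
      · exact ⟨2, le_rfl, h2⟩
    · rintro ⟨j, hj, hc⟩
      have hb' : (decide ((G a h).CheckAt ((sc : ℚ) / N) ((δ₀ : ℚ) / N) s₀ T Bf 0) ||
          (decide ((G a h).CheckAt ((sc : ℚ) / N) ((δ₀ : ℚ) / N) s₀ T Bf 1) ||
            decide ((G a h).CheckAt ((sc : ℚ) / N) ((δ₀ : ℚ) / N) s₀ T Bf 2))) = true := by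
        simp only [Bool.or_eq_true, decide_eq_true_eq]
        interval_cases j
        · exact Or.inl hc
        · exact Or.inr (Or.inl hc)
        · exact Or.inr (Or.inr hc)
      simp [bitE, hb']

end Steps

end IntWalkOps

end Literature.Computability.Cryptography

end
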